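import Summits.BirchSwinnertonDyer.BirchSwinnertonDyer.Theorems.EisensteinPrimesAlgebraicLambdaGEBudget
import Summits.BirchSwinnertonDyer.Rank1Residual.X1.GeneratorCountLayerAtP
import Summits.BirchSwinnertonDyer.Rank1Residual.X1.GeneratorCountTorsion
import Summits.BirchSwinnertonDyer.Rank1Residual.X2.GreenbergSelmerCountSplit
import Summits.BirchSwinnertonDyer.Rank1Residual.Additive.UnramifiedClassesLocal
import Literature.NumberTheory.EllipticCurves.TateCurve.NumberFieldUniformizationTwisted
import HarnessLib

/-!
# The local term `a ≥ 1` at the prime above `p` for route T's generator count, as a SOCKET: one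
# local class of order `p` in `ker(H¹(ℚ_p, E) → H¹(ℚ_{∞,π}, E))` gives `p^{#T₀ + 1}` level-`0` classes
# (any reduction type at `p`; any `E(ℚ)[p]`), hence `GeneratorCountGE` / `AlgebraicLambdaGE` with `+1`
# (route `EisensteinPrimes`, line `mudescent`, stub `stub_lambdaCount_offLocus`, ALGEBRAIC side;
# seat bsd-eis-lam-b g2, PROGRAMME PART 1b seat (5))

HONEST FRAMING (cell `bsd-eis`; no tranche here proves BSD): THEOREMS ONLY — no definition, no named
fact, nothing asserted about any particular curve, closes nothing, moves no label. Helper for the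
`mudescent` compositions (items -19033 / -19035). Census finding of this seat (HOME STATUS,
2026-08-26): EVERY route-T closure on the type-A multiplicative row (X2b) binds at the `μ = 0` member
WITH a rational point of order `p` (`δ = 1`) and the local term `a = 1` at the SPLIT prime `p`; the
kernel had `a` only at a good ANOMALOUS `p` (`X1/GeneratorCountAnomalous*`: there EVERY class of
`H¹(ℚ_p, E[p])` is Selmer over `ℚ_∞`). At a split multiplicative `p` only an index-`p` subgroup is, and
the right input is Greenberg's «`ker(r_π) ≠ 0`» (LNM 1716 §3 pp. 91–93). This file is the SOCKET
taking that input as ONE local class `ξ ∈ H¹(Γ_{ℚ_p}, E(ℚ̄_p))` (`ξ ≠ 0`, `p • ξ = 0`, `ξ` in the image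
of `H¹(ℚ_p, E[p])`, `res ξ = 0` on `Gal(ℚ̄_p/ℚ_{∞,π})`); the companion file discharges it at a split
`p` from a rational point of order `p`.

* §1 (any number field) `layerToInfty_resH1Hom_torsionToPrimaryH1_mem_localKerOver_of_map_res_mem_zmultiples`
  (the `K_∞`-local condition of `h_0(Ψ y)` when the localisation of `y` is a multiple of `ξ`; the
  bookkeeping of n1011's `…_of_mem_unramified_sup_kummer`); `natCard_comap_eq_mul_of_le_range`.
* §2 (over `ℚ`) the local package `𝓛_ξ = θ⁻¹(ℤ·ξ) ⊇ 𝓚_v = ker θ` of index `p`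
  (`kummer_le_comap_zmultiples_and_natCard`) and, for ANY `E(ℚ)[p]`,
  `generatorCountGE_of_localKernelClass_torsion`: `GeneratorCountGE W p b` for `b + 2k ≤ #T₀ + 1`
  (`#E[p^∞]^{Γ_ℚ} ≤ p^k`, so `k = 0` when `E(ℚ)[p] = 0`; n1011's `exists_addSubgroup_relaxedKummer_at`
  + eisenstein-p1's lossy count `GeneratorCountTorsion.natCard_le_natCard_quotient_maximalIdeal_mul_sq`).
* §3 (X2) `X2.generatorCountGE_of_localKernelClass_torsion_mult` (finiteness of `E(ℚ_∞)[p^∞]` at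
  `p ‖ N` from the Tate uniformisation A41, tree `_holds`) and the λ-bound
  `X2.algebraicLambdaGE_of_localKernelClass_torsion` (`AlgebraicLambdaGE W p (b − m)` at a `μ_an ≤ m`
  member, through p469158's `X2.algebraicLambdaGE_of_generatorCountGE_of_analyticMuLE`).

Named PUBLISHED facts as hypotheses exactly as in the composed files: Poitou–Tate duality for Selmer
structures over `ℚ` (`hPT`), Prop. 4.15 (ii) (`h415`), Wuthrich Thm. 16 (`hWu`), modularity; the local
Euler–Poincaré formula over `ℚ` and the Tate uniformisation are tree theorems.
References: [GreenbergLNM1716] §3 pp. 85–93, §5 pp. 114–118 (proof of Cor. 5.6), p. 137;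
[MilneADT2006] I Thm. 2.8, Thm. 4.10; HOME/b2b-bsdres-eisenstein-p2/routeT/README.md; X1R0-GAPMAP §14.1.
-/

set_option autoImplicit false
-- `Summit.BirchSwinnertonDyer.BirchSwinnertonDyer.…`: the summit and its single sub-problem share a name (D-0017 layout).
set_option linter.dupNamespace false

noncomputable section

open scoped Classical

open Function Field NumberField IsDedekindDomain WeierstrassCurve
  Literature.NumberTheory.EllipticCurves Literature.NumberTheory.GaloisRepresentations
  Literature.NumberTheory.GaloisCohomology Summit.BirchSwinnertonDyer.Rank1Residual.GaloisImage
  Literature.NumberTheory.EllipticCurves.Rank1Residual Literature.NumberTheory.EllipticCurves.ModularForms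
  Summit.BirchSwinnertonDyer.Rank1Residual
  Summit.BirchSwinnertonDyer.Rank1Residual.X1.GeneratorCountSqueeze
  Summit.BirchSwinnertonDyer.Rank1Residual.X1.TamagawaSqueeze
  Summit.BirchSwinnertonDyer.Rank1Residual.Additive
  Summit.BirchSwinnertonDyer.BirchSwinnertonDyer.Theorems.EisensteinPrimesAlgebraicLambdaGEBudget
open Literature.NumberTheory.GaloisRepresentations.DiscreteGaloisModule (SelmerStructure unramifiedSubgroup)

namespace Summit.BirchSwinnertonDyer.BirchSwinnertonDyer.Theorems.EisensteinPrimesX2GeneratorCountAtP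

universe u

/-! ## §1. Local bookkeeping (any number field, any place, any `ℤ_p`-extension) -/

section Local

variable {K : Type u} [Field K] [NumberField K] (W : WeierstrassCurve K) [W.IsElliptic] (p : ℕ)
  [hp : Fact p.Prime] (κ : ZpExtension K p) (v : HeightOneSpectrum (𝓞 K))

omit [W.IsElliptic] in
/-- **The `K_∞`-level local condition from ONE local class dying over `K_{∞,η}`.** Let
`ξ ∈ H¹(Γ_{K_v}, E(K̄_v))` restrict to `0` on `Gal(K̄_v/K_{∞,η}K_v)` (`localSubgroup (ker κ) K_v`), and
let `y ∈ H¹(K, E[p])` have localisation at `v` whose image in `H¹(Γ_{K_v}, E(K̄_v))` is a multiple of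
`ξ`. Then `h_0(Ψ y) ∈ H¹(K_∞, E[p^∞])` lies in the local kernel `localKerOver p (ker κ) K_v` (the
local condition of `Sel_{p^∞}(E/K_∞)` at the prime of `K_∞` over `v` singled out by the chosen
embedding). [cite: GreenbergLNM1716, §2–§3 (pp. 85–86)] -/
theorem layerToInfty_resH1Hom_torsionToPrimaryH1_mem_localKerOver_of_map_res_mem_zmultiples
    (ξ : galoisCohomology (W.localGaloisModule (v.adicCompletion K)) 1)
    (hξ : resH1Hom (Literature.NumberTheory.EllipticCurves.subgroupIncl
        (localSubgroup κ.kerSubgroup (v.adicCompletion K)))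
        (AddMonoidHom.id (localPoints W (v.adicCompletion K))) (fun _ _ ↦ rfl) ξ = 0)
    (y : galH1Torsion W (p : ℤ))
    (hy : galoisCohomology.map (W.torsionPointsMapIntertwining (p : ℤ) (v.adicCompletion K)) 1
        (galoisCohomology.res (W.torsionGaloisModule (p : ℤ)) (v.adicCompletion K) 1 y) ∈
      AddSubgroup.zmultiples ξ) :
    W.layerToInfty κ 0 (resH1Hom (Literature.NumberTheory.EllipticCurves.subgroupIncl (κ.layerSubgroup 0))
        (AddMonoidHom.id (geomPrimaryTorsion W p)) (fun _ _ ↦ rfl) (torsionToPrimaryH1 W p y)) ∈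
      W.localKerOver p κ.kerSubgroup (v.adicCompletion K) := by
  rw [mem_localKerOver_iff]
  -- `h_0 ∘ res_{K_0} = res_{K_∞}` on `H¹(K, E[p^∞])`
  have e1 : ∀ c : W.galH1Primary p,
      W.layerToInfty κ 0 (resH1Hom (Literature.NumberTheory.EllipticCurves.subgroupIncl (κ.layerSubgroup 0))
        (AddMonoidHom.id (geomPrimaryTorsion W p)) (fun _ _ ↦ rfl) c) =
      resH1Hom (Literature.NumberTheory.EllipticCurves.subgroupIncl κ.kerSubgroup)
        (AddMonoidHom.id (geomPrimaryTorsion W p)) (fun _ _ ↦ rfl) c := fun c ↦ by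
    change resH1Hom (subgroupInclusion (κ.kerSubgroup_le_layerSubgroup 0))
      (AddMonoidHom.id (geomPrimaryTorsion W p)) (fun _ _ ↦ rfl) (resH1Hom _ _ _ c) = _
    rw [resH1Hom_resH1Hom]
    exact DFunLike.congr_fun (resH1Hom_congr (by ext; rfl) (by ext; rfl) _ _) c
  -- the local restriction over `K_∞` after `res_{K_∞}`
  have e2 : ∀ c : W.galH1Primary p,
      W.localResOver p κ.kerSubgroup (v.adicCompletion K)
        (resH1Hom (Literature.NumberTheory.EllipticCurves.subgroupIncl κ.kerSubgroup)
          (AddMonoidHom.id (geomPrimaryTorsion W p)) (fun _ _ ↦ rfl) c) =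
      resH1Hom (Literature.NumberTheory.EllipticCurves.subgroupIncl
          (localSubgroup κ.kerSubgroup (v.adicCompletion K)))
        (AddMonoidHom.id (localPoints W (v.adicCompletion K))) (fun _ _ ↦ rfl)
        (resH1Hom (resGal (K := K) (v.adicCompletion K))
          ((pointsMap W (v.adicCompletion K)).comp (geomPrimaryTorsion W p).subtype)
          (W.pointsMap_comp_subtype_smul p) c) := fun c ↦ by
    show resH1Hom (resGalSubgroupOfEmb κ.kerSubgroup (closureEmb (K := K) (v.adicCompletion K)))
        ((pointsMapOfEmb W (closureEmb (K := K) (v.adicCompletion K))).comp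
          (geomPrimaryTorsion W p).subtype)
        (W.pointsMapOfEmb_comp_subtype_smul p (closureEmb (K := K) (v.adicCompletion K)) κ.kerSubgroup)
        (resH1Hom (Literature.NumberTheory.EllipticCurves.subgroupIncl κ.kerSubgroup)
          (AddMonoidHom.id (geomPrimaryTorsion W p)) (fun _ _ ↦ rfl) c) = _
    rw [resH1Hom_resH1Hom, resH1Hom_resH1Hom]
    exact DFunLike.congr_fun (resH1Hom_congr (by ext; rfl) (by ext; rfl) _ _) c
  -- `(E[p] ↪ E[p^∞])_*` then the pair `(resGal, pointsMap ∘ incl)` = `map ∘ res`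
  have e3 : resH1Hom (resGal (K := K) (v.adicCompletion K))
        ((pointsMap W (v.adicCompletion K)).comp (geomPrimaryTorsion W p).subtype)
        (W.pointsMap_comp_subtype_smul p) (torsionToPrimaryH1 W p y) =
      galoisCohomology.map (W.torsionPointsMapIntertwining (p : ℤ) (v.adicCompletion K)) 1
        (galoisCohomology.res (W.torsionGaloisModule (p : ℤ)) (v.adicCompletion K) 1 y) := by
    rw [map_res_torsionGaloisModule_apply, torsionToPrimaryH1, resH1Hom_resH1Hom]
    exact DFunLike.congr_fun (resH1Hom_congr (by ext; rfl) (by ext; rfl) _ _) y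
  rw [e1, e2, e3]
  -- `ℤ·ξ ≤ ker(res to K_{∞,η})`, so the localisation of `y` dies there (no `ℤ`-action bookkeeping)
  have hker : AddSubgroup.zmultiples ξ ≤
      (resH1Hom (Literature.NumberTheory.EllipticCurves.subgroupIncl
          (localSubgroup κ.kerSubgroup (v.adicCompletion K)))
        (AddMonoidHom.id (localPoints W (v.adicCompletion K))) (fun _ _ ↦ rfl)).ker :=
    AddSubgroup.zmultiples_le_of_mem ((AddMonoidHom.mem_ker).mpr hξ)
  exact (AddMonoidHom.mem_ker).mp (hker hy)

omit [NumberField K] [W.IsElliptic] in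
/-- **`#(f⁻¹ S) = #ker f · #S` for a subgroup `S ≤ range f`** (`Nat.card`; the restriction
`f⁻¹ S → S` is onto with kernel `ker f`). Used for the index of the local package
`𝓛_ξ = θ⁻¹(ℤ·ξ) ⊇ ker θ = 𝓚_v` (`θ : H¹(K_v, E[p]) → H¹(Γ_{K_v}, E(K̄_v))`). [folklore] -/
theorem natCard_comap_eq_mul_of_le_range {A B : Type*} [AddCommGroup A] [AddCommGroup B]
    (f : A →+ B) (S : AddSubgroup B) (hS : S ≤ f.range) :
    Nat.card (S.comap f) = Nat.card f.ker * Nat.card S := by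
  -- the restriction `g : f⁻¹ S → S`
  let g : S.comap f →+ S := (f.comp (S.comap f).subtype).codRestrict S fun x ↦ x.2
  have hg : Function.Surjective g := by
    rintro ⟨s, hs⟩
    obtain ⟨a, ha⟩ := hS hs
    exact ⟨⟨a, by rw [AddSubgroup.mem_comap, ha]; exact hs⟩, Subtype.ext ha⟩
  -- its kernel is `ker f`
  have hker : Nat.card g.ker = Nat.card f.ker := by
    refine Nat.card_congr
      { toFun := fun x ↦ ⟨(x.1 : A), by
          have h := x.2
          rw [AddMonoidHom.mem_ker] at h ⊢
          exact congrArg Subtype.val h⟩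
        invFun := fun a ↦ ⟨⟨a.1, by
          rw [AddSubgroup.mem_comap, (AddMonoidHom.mem_ker).mp a.2]; exact zero_mem _⟩, by
          rw [AddMonoidHom.mem_ker]
          exact Subtype.ext ((AddMonoidHom.mem_ker).mp a.2)⟩
        left_inv := fun x ↦ by ext; rfl
        right_inv := fun a ↦ by ext; rfl }
  rw [AddSubgroup.card_eq_card_quotient_mul_card_addSubgroup g.ker, hker,
    Nat.card_congr (QuotientAddGroup.quotientKerEquivOfSurjective g hg).toEquiv, mul_comm]

end Local

/-! ## §2. Over `ℚ`: `p^{#T₀ + 1}` level-`0` classes from ONE local kernel class at `p` -/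

section Rat

variable {W : WeierstrassCurve ℚ} [W.IsElliptic] [W.IsGloballyMinimal] {p : ℕ} [hp : Fact p.Prime]

omit [W.IsElliptic] [W.IsGloballyMinimal] in
/-- **The local package at `v ∋ p` from one local kernel class.** For
`θ = H¹(ℚ_v, E[p]) → H¹(Γ_{ℚ_v}, E(ℚ̄_v))` and `ξ` in the image of `θ` with `ξ ≠ 0`, `p • ξ = 0`:
`𝓛_ξ := θ⁻¹(ℤ·ξ)` contains the Kummer condition `𝓚_v = ker θ` and `#𝓛_ξ = p · #𝓚_v`.
[cite: GreenbergLNM1716, §3 pp. 91–93] -/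
theorem kummer_le_comap_zmultiples_and_natCard (v : HeightOneSpectrum (𝓞 ℚ))
    (ξ : galoisCohomology (W.localGaloisModule (v.adicCompletion ℚ)) 1) (hξ0 : ξ ≠ 0)
    (hξp : p • ξ = 0)
    (hξr : ξ ∈ (galoisCohomology.map (W.torsionPointsMapIntertwining (p : ℤ) (v.adicCompletion ℚ)) 1).range) :
    W.kummerSelmerStructure (p : ℤ) (Sum.inr v) ≤
        (AddSubgroup.zmultiples ξ).comap
          (galoisCohomology.map (W.torsionPointsMapIntertwining (p : ℤ) (v.adicCompletion ℚ)) 1) ∧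
      p * Nat.card (W.kummerSelmerStructure (p : ℤ) (Sum.inr v)) =
        Nat.card ((AddSubgroup.zmultiples ξ).comap
          (galoisCohomology.map (W.torsionPointsMapIntertwining (p : ℤ) (v.adicCompletion ℚ)) 1)) := by
  -- `𝓚_v = ker θ` (definitional: `kummerSelmerStructure` at `inr v` is `kummerLocalConditionAt` at `ℚ_v`)
  have hK : Nat.card (W.kummerSelmerStructure (p : ℤ) (Sum.inr v)) = Nat.card
      (galoisCohomology.map (W.torsionPointsMapIntertwining (p : ℤ) (v.adicCompletion ℚ)) 1).ker :=
    rfl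
  refine ⟨fun c hc ↦ ?_, ?_⟩
  · have hc' : galoisCohomology.map (W.torsionPointsMapIntertwining (p : ℤ) (v.adicCompletion ℚ)) 1 c =
        0 := hc
    show galoisCohomology.map (W.torsionPointsMapIntertwining (p : ℤ) (v.adicCompletion ℚ)) 1 c ∈
      AddSubgroup.zmultiples ξ
    rw [hc']
    exact zero_mem _
  · have hS : AddSubgroup.zmultiples ξ ≤
        (galoisCohomology.map (W.torsionPointsMapIntertwining (p : ℤ) (v.adicCompletion ℚ)) 1).range :=
      (AddSubgroup.zmultiples_le_of_mem hξr)
    rw [natCard_comap_eq_mul_of_le_range _ _ hS, ← hK, Nat.card_zmultiples, mul_comm]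
    congr 1
    -- `addOrderOf ξ = p`
    have hdvd : addOrderOf ξ ∣ p := addOrderOf_dvd_of_nsmul_eq_zero hξp
    rcases (Nat.dvd_prime hp.out).mp hdvd with h1 | h2
    · exact absurd (AddMonoid.addOrderOf_eq_one_iff.mp h1) hξ0
    · exact h2.symm

/-- **`GeneratorCountGE W p b` for `b + 2k ≤ #T₀ + 1`, ANY `E(ℚ)[p]`** (`δ = 1` allowed): Tamagawa
witnesses on `T₀`, ONE local kernel class at `p` (`a ≥ 1`), `#E[p^∞]^{Γ_ℚ} ≤ p^k`, `E(ℚ_∞)[p^∞]`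
finite (`hfix`): `p^{#T₀ + 1}` relaxed classes (`𝓛_ξ` of index `p` at `v_p`), Selmer over `ℚ_∞`
everywhere (§1 at `v_p`), converted by the LOSSY count `#S ≤ #(X/𝔪X) · (#E[p^∞]^{Γ_ℚ})²` — X1R0-GAPMAP
§14.1's `B = t₀ + a − 2δ` with `a = 1`, the shape of every route-T closure on the type-A multiplicative
row. [cite: GreenbergLNM1716, §3 Lemma 3.1, pp. 91–93, §5 pp. 114–118, p. 137] -/
theorem generatorCountGE_of_localKernelClass_torsion (hodd : p ≠ 2)
    (hPT : poitouTate_selmerStructure_duality ℚ)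
    (hfix : ∀ κ : ZpExtension ℚ p, κ.IsCyclotomic →
      Finite (FixedPoints.addSubgroup κ.kerSubgroup (W.geomPrimaryTorsion p)))
    {k : ℕ}
    (hB : Nat.card {a : geomPrimaryTorsion W p // ∀ σ : absoluteGaloisGroup ℚ, σ • a = a} ≤ p ^ k)
    (T₀ : Finset (HeightOneSpectrum (𝓞 ℚ))) (hT₀p : ∀ v ∈ T₀, ((p : ℕ) : 𝓞 ℚ) ∉ v.asIdeal)
    (hwit : ∀ v ∈ T₀, ∃ u ∈ unramifiedSubgroup
        ((W.torsionGaloisModule (p : ℤ)).restrictField (v.adicCompletion ℚ)) 1,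
      u ∉ W.kummerLocalConditionAt (p : ℤ) (v.adicCompletion ℚ))
    (vp : HeightOneSpectrum (𝓞 ℚ)) (hvp : ((p : ℕ) : 𝓞 ℚ) ∈ vp.asIdeal)
    (hξ : ∀ κ : ZpExtension ℚ p, κ.IsCyclotomic →
      ∃ ξ : galoisCohomology (W.localGaloisModule (vp.adicCompletion ℚ)) 1, ξ ≠ 0 ∧ p • ξ = 0 ∧
        ξ ∈ (galoisCohomology.map (W.torsionPointsMapIntertwining (p : ℤ) (vp.adicCompletion ℚ)) 1).range ∧
        resH1Hom (Literature.NumberTheory.EllipticCurves.subgroupIncl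
            (localSubgroup κ.kerSubgroup (vp.adicCompletion ℚ)))
          (AddMonoidHom.id (localPoints W (vp.adicCompletion ℚ))) (fun _ _ ↦ rfl) ξ = 0)
    {b : ℕ} (hb : b + 2 * k ≤ T₀.card + 1) : GeneratorCountGE W p b := by
  haveI : NeZero p := ⟨hp.out.ne_zero⟩
  obtain ⟨inv, hperf, hsum, -, hcompl⟩ := hPT p
  have hvpT₀ : vp ∉ T₀ := fun h ↦ hT₀p vp h hvp
  intro κ γ hκ _ _ D _ _
  haveI := hfix κ hκ
  obtain ⟨ξ, hξ0, hξp, hξr, hξK⟩ := hξ κ hκ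
  obtain ⟨h𝓛, hcard⟩ := kummer_le_comap_zmultiples_and_natCard vp ξ hξ0 hξp hξr
  let 𝓛 : ∀ v : HeightOneSpectrum (𝓞 ℚ),
      AddSubgroup (galoisCohomology ((W.torsionGaloisModule (p : ℤ)).toLocal (Sum.inr v)) 1) :=
    Function.update (fun _ ↦ ⊤) vp
      ((AddSubgroup.zmultiples ξ).comap
        (galoisCohomology.map (W.torsionPointsMapIntertwining (p : ℤ) (vp.adicCompletion ℚ)) 1))
  have h𝓛vp : 𝓛 vp = (AddSubgroup.zmultiples ξ).comap
      (galoisCohomology.map (W.torsionPointsMapIntertwining (p : ℤ) (vp.adicCompletion ℚ)) 1) :=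
    Function.update_self _ _ _
  obtain ⟨Sg, hSfin, hScard, hS⟩ := X1.GeneratorCountLayerAtP.exists_addSubgroup_relaxedKummer_at
    (W := W) hodd inv hperf hsum hcompl (EP.forall_localEulerPoincareCharacteristic_adicCompletion ℚ)
    T₀ hwit vp hvpT₀ 𝓛 (by rw [h𝓛vp]; exact h𝓛) (by rw [h𝓛vp]; exact hcard.le)
  haveI := hSfin
  have hcount := X1.GeneratorCountTorsion.natCard_le_natCard_quotient_maximalIdeal_mul_sq W κ D Sg
    (↑(insert vp T₀) : Set (HeightOneSpectrum (𝓞 ℚ))) (fun y hy v hv ↦ (hS y hy).1 v hv)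
    (fun y hy w ↦ (hS y hy).2.1 w) fun y hy v hv ↦ by
      rcases Finset.mem_insert.mp (Finset.mem_coe.mp hv) with rfl | hv
      · have hy' := (hS y hy).2.2.2
        rw [h𝓛vp] at hy'
        have hy'' : galoisCohomology.map (W.torsionPointsMapIntertwining (p : ℤ) (v.adicCompletion ℚ)) 1
            (galoisCohomology.res (W.torsionGaloisModule (p : ℤ)) (v.adicCompletion ℚ) 1 y) ∈
            AddSubgroup.zmultiples ξ := hy'
        exact layerToInfty_resH1Hom_torsionToPrimaryH1_mem_localKerOver_of_map_res_mem_zmultiples W p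
          κ v ξ hξK y hy''
      · exact Additive.layerToInfty_resH1Hom_torsionToPrimaryH1_mem_localKerOver_of_mem_unramified_sup_kummer
          W p κ v (hT₀p v hv) (Additive.exists_apply_resGal_ne_one_of_isCyclotomic κ hκ v (hT₀p v hv)) y
          ((hS y hy).2.2.1 v hv)
  have h1 : p ^ b * p ^ (2 * k) ≤ Nat.card (D.X ⧸ IsLocalRing.maximalIdeal (IwasawaAlgebra p) •
      (⊤ : Submodule (IwasawaAlgebra p) D.X)) * p ^ (2 * k) :=
    calc p ^ b * p ^ (2 * k) = p ^ (b + 2 * k) := (pow_add p b (2 * k)).symm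
      _ ≤ p ^ (T₀.card + 1) := Nat.pow_le_pow_right hp.out.pos hb
      _ ≤ Nat.card Sg := hScard
      _ ≤ _ := hcount
      _ ≤ Nat.card (D.X ⧸ IsLocalRing.maximalIdeal (IwasawaAlgebra p) •
            (⊤ : Submodule (IwasawaAlgebra p) D.X)) * (p ^ k) ^ 2 :=
          Nat.mul_le_mul_left _ (Nat.pow_le_pow_left hB 2)
      _ = _ := by rw [← pow_mul, mul_comm k 2]
  exact Nat.le_of_mul_le_mul_right h1 (pow_pos hp.out.pos _)

end Rat

/-! ## §3. X2: a multiplicative Eisenstein prime — the count and the λ-bound at a `μ_an ≤ m` member -/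

section X2

variable {W : WeierstrassCurve ℚ} [W.IsElliptic] [W.IsGloballyMinimal] {p : ℕ} [hp : Fact p.Prime]

/-- **X2 count with the local term at `p ‖ N`: `GeneratorCountGE W p b` for `b + 2k ≤ #T₀ + 1`** —
§2 with `E(ℚ_∞)[p^∞]` finite at an odd multiplicative `p` (X2's
`finite_fixedPoints_kerSubgroup_of_hasMultiplicativeReductionAtPrime`, from the PUBLISHED twisted Tate
uniformisation A41, DISCHARGED in the tree: `TateCurve.Silverman1994_thmV53_corV54_tateUniformisation_holds`).
[cite: GreenbergLNM1716, §1 p. 62, §3 pp. 86–93, §5 pp. 114–118, p. 137]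
[cite: SilvermanATAEC1994, Thm. V.5.3, Cor. V.5.4] -/
theorem X2.generatorCountGE_of_localKernelClass_torsion_mult (hodd : p ≠ 2)
    (hPT : poitouTate_selmerStructure_duality ℚ) (hmult : W.HasMultiplicativeReductionAtPrime p)
    {k : ℕ}
    (hB : Nat.card {a : geomPrimaryTorsion W p // ∀ σ : absoluteGaloisGroup ℚ, σ • a = a} ≤ p ^ k)
    (T₀ : Finset (HeightOneSpectrum (𝓞 ℚ))) (hT₀p : ∀ v ∈ T₀, ((p : ℕ) : 𝓞 ℚ) ∉ v.asIdeal)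
    (hwit : ∀ v ∈ T₀, ∃ u ∈ unramifiedSubgroup
        ((W.torsionGaloisModule (p : ℤ)).restrictField (v.adicCompletion ℚ)) 1,
      u ∉ W.kummerLocalConditionAt (p : ℤ) (v.adicCompletion ℚ))
    (vp : HeightOneSpectrum (𝓞 ℚ)) (hvp : ((p : ℕ) : 𝓞 ℚ) ∈ vp.asIdeal)
    (hξ : ∀ κ : ZpExtension ℚ p, κ.IsCyclotomic →
      ∃ ξ : galoisCohomology (W.localGaloisModule (vp.adicCompletion ℚ)) 1, ξ ≠ 0 ∧ p • ξ = 0 ∧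
        ξ ∈ (galoisCohomology.map (W.torsionPointsMapIntertwining (p : ℤ) (vp.adicCompletion ℚ)) 1).range ∧
        resH1Hom (Literature.NumberTheory.EllipticCurves.subgroupIncl
            (localSubgroup κ.kerSubgroup (vp.adicCompletion ℚ)))
          (AddMonoidHom.id (localPoints W (vp.adicCompletion ℚ))) (fun _ _ ↦ rfl) ξ = 0)
    {b : ℕ} (hb : b + 2 * k ≤ T₀.card + 1) : GeneratorCountGE W p b :=
  generatorCountGE_of_localKernelClass_torsion hodd hPT
    (fun κ hκ ↦ X2.GreenbergVatsalTransferMultiplicative.finite_fixedPoints_kerSubgroup_of_hasMultiplicativeReductionAtPrime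
      W p TateCurve.Silverman1994_thmV53_corV54_tateUniformisation_holds hodd hmult κ hκ)
    hB T₀ hT₀p hwit vp hvp hξ hb

/-- **X2, the λ-bound: `AlgebraicLambdaGE W p (b − m)` for `b + 2k ≤ #T₀ + 1` at a member with
`μ_an ≤ m`** (`p ‖ N` odd, `E[p]` reducible): §3's count through this seat's
`X2.algebraicLambdaGE_of_generatorCountGE_of_analyticMuLE` (Greenberg's inequality
`#(X/𝔪X) ≤ p^{λ+μ}`, Prop. 4.15 (ii) at `p ‖ N`, Wuthrich Thm. 16 for `μ ≤ μ_an ≤ m`). With `k = 1`,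
`m = 0`, `b = #T₀ − 1` this is the binding certificate `λ ≥ t₀ + 1 − 2` of the X2b route-T rows, IN
THE KERNEL modulo `hPT` / `h415` / `hWu` / modularity and the ONE local input `hξ`.
[cite: GreenbergLNM1716, §3 pp. 91–93, §5 pp. 114–118, p. 137, Prop. 4.15 (ii)] [cite: Wuthrich2014, Thm. 16 (p. 397)] -/
theorem X2.algebraicLambdaGE_of_localKernelClass_torsion (hodd : p ≠ 2)
    (hPT : poitouTate_selmerStructure_duality ℚ)
    (h415 : Greenberg1999.prop415ii_noFiniteSubmodule_of_ordinary_or_multiplicative)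
    (hWu : Wuthrich2014.thm16_charIdeal_dvd_multiplicative_of_reducible)
    (hpar : nonempty_modularParametrizationData)
    (hmult : W.HasMultiplicativeReductionAtPrime p) (hred : ¬ W.HasIrreducibleModPGaloisRep p)
    {k : ℕ}
    (hB : Nat.card {a : geomPrimaryTorsion W p // ∀ σ : absoluteGaloisGroup ℚ, σ • a = a} ≤ p ^ k)
    (T₀ : Finset (HeightOneSpectrum (𝓞 ℚ))) (hT₀p : ∀ v ∈ T₀, ((p : ℕ) : 𝓞 ℚ) ∉ v.asIdeal)
    (hwit : ∀ v ∈ T₀, ∃ u ∈ unramifiedSubgroup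
        ((W.torsionGaloisModule (p : ℤ)).restrictField (v.adicCompletion ℚ)) 1,
      u ∉ W.kummerLocalConditionAt (p : ℤ) (v.adicCompletion ℚ))
    (vp : HeightOneSpectrum (𝓞 ℚ)) (hvp : ((p : ℕ) : 𝓞 ℚ) ∈ vp.asIdeal)
    (hξ : ∀ κ : ZpExtension ℚ p, κ.IsCyclotomic →
      ∃ ξ : galoisCohomology (W.localGaloisModule (vp.adicCompletion ℚ)) 1, ξ ≠ 0 ∧ p • ξ = 0 ∧
        ξ ∈ (galoisCohomology.map (W.torsionPointsMapIntertwining (p : ℤ) (vp.adicCompletion ℚ)) 1).range ∧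
        resH1Hom (Literature.NumberTheory.EllipticCurves.subgroupIncl
            (localSubgroup κ.kerSubgroup (vp.adicCompletion ℚ)))
          (AddMonoidHom.id (localPoints W (vp.adicCompletion ℚ))) (fun _ _ ↦ rfl) ξ = 0)
    {m : ℕ} (hμ : X2.AnalyticMuLE W p m) {b : ℕ} (hb : b + 2 * k ≤ T₀.card + 1) :
    AlgebraicLambdaGE W p (b - m) :=
  X2.algebraicLambdaGE_of_generatorCountGE_of_analyticMuLE hWu hpar h415 hodd hmult hred hμ
    (X2.generatorCountGE_of_localKernelClass_torsion_mult hodd hPT hmult hB T₀ hT₀p hwit vp hvp hξ hb)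

end X2

end Summit.BirchSwinnertonDyer.BirchSwinnertonDyer.Theorems.EisensteinPrimesX2GeneratorCountAtP

end
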